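import Summits.AtomisticToContinuum.Crystallization.Theorems.ShellTrichotomy.Negative.LinkPath

/-!
# `ShellTrichotomy` (stmt-AtomisticToContinuum-18070), negative side III: radius window and cardinality

* `shellTrichotomy_false_without_radiusWindow`: the crux with `1 - 1/50 ≤ ‖v‖ ≤ 1 + 1/50` deleted (inline) is FALSE:
  the fcc pattern translated by `(3, 0, 0)` keeps every pair distance (hard core, bonds, gap, all
  degrees `4`) but has all norms `≥ 2`, and the conclusion's isometries are LINEAR (unit-sphere patterns
  stay on the unit sphere), so no `1/5`-matching exists.  The radius window is what pins the centre.
* `shellTrichotomy_false_without_card`: the crux with `T.card = 12` deleted (inline) is FALSE, degenerately: `T = ∅`.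
* On the way: `fcc_pairs` (fcc pair distances are `1` or `≥ √2`: `≥ 49/50`, and `≤ 51/50 ∨ ≥ 63/50`) and
  `fcc_degree` (every fcc point has exactly four pattern points within `51/50`), from the integer model.

Negative-side support (no route item is concluded positively).  Disprover seat
refuter-cdisprove-stmt-AtomisticToContinuum-18070-0, 2026-08-17.
-/

noncomputable section

namespace Summit.AtomisticToContinuum.Crystallization.Theorems.ShellTrichotomyNegative

open Literature.Geometry.DiscreteGeometry
open Summit.AtomisticToContinuum.Crystallization.Theorems.ShellCensusNegative

/-! ### The radius window is load-bearing: a translated cuboctahedron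

Drop only the hypothesis `49/50 ≤ ‖v‖ ≤ 51/50`. The fcc pattern translated by `(3, 0, 0)` keeps every
pair distance (all-degree-4, gapped, hard core) but every point has norm `≥ 2`, while a linear isometry
keeps the pattern on the unit sphere: no `1/5`-matching. (The conclusion's isometries are LINEAR, so the
radius window is what pins the centre; with it, translations are limited to `±1/50`.) -/

/-- fcc integer model: distinct vectors are at squared distance `2` (bond) or `≥ 4`. [cite: ConwaySloane1999, Ch. 4 §6.3] -/
theorem fccInt_gap : ∀ v ∈ fccInt, ∀ w ∈ fccInt, v ≠ w → sqNormInt (v - w) ≤ 2 ∨ (4 : ℤ) ≤ sqNormInt (v - w) := by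
  decide
/-- fcc integer model: exactly four vectors at squared distance `≤ 2` from each vector. [cite: ConwaySloane1999, Ch. 4 §6.3] -/
theorem fccInt_degree : ∀ v ∈ fccInt, (fccInt.filter fun w => w ≠ v ∧ sqNormInt (v - w) ≤ 2).card = 4 := by
  decide

/-- the scaling map of the fcc pattern [folklore] -/
def fmap (v : Fin 3 → ℤ) : (EuclideanSpace ℝ (Fin 3)) := (Real.sqrt (2 : ℕ))⁻¹ • intVec v

/-- the fcc scaling map is injective. [folklore] -/
theorem fmap_injective : Function.Injective fmap := scaledPattern_map_injective (N := 2) two_ne_zero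
/-- the fcc pattern as the image of its integer model (definitional). [folklore] -/
theorem fcc_eq_image : fccKissingPattern = fccInt.image fmap := rfl

/-- distances in the fcc pattern from the integer model. [folklore] -/
theorem dist_fmap (v w : Fin 3 → ℤ) : dist (fmap v) (fmap w) = (Real.sqrt 2)⁻¹ * Real.sqrt (sqNormInt (v - w) : ℝ) := by
  have hc : (0 : ℝ) ≤ (Real.sqrt (2 : ℕ))⁻¹ := by positivity
  have := dist_scaled_intVec _ hc v w
  simpa [fmap] using this

/-- bond test on the fcc model: `dist ≤ 51/50 ↔ squared integer distance ≤ 2`. [folklore] -/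
theorem dist_fmap_le_iff {v w : Fin 3 → ℤ} (hv : v ∈ fccInt) (hw : w ∈ fccInt) (hvw : v ≠ w) :
    dist (fmap v) (fmap w) ≤ 1 + 1 / 50 ↔ sqNormInt (v - w) ≤ 2 := by
  have hs2 : 0 < Real.sqrt 2 := Real.sqrt_pos.2 (by norm_num)
  have hs2sq : Real.sqrt 2 ^ 2 = 2 := Real.sq_sqrt (by norm_num)
  rw [dist_fmap, inv_mul_le_iff₀ hs2]
  constructor
  · intro h
    rcases fccInt_gap v hv w hw hvw with h2 | h4
    · exact h2
    · exfalso
      have h4' : ((4 : ℤ) : ℝ) ≤ (sqNormInt (v - w) : ℝ) := by exact_mod_cast h4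
      have : (2 : ℝ) ≤ Real.sqrt (sqNormInt (v - w) : ℝ) := by
        rw [show (2 : ℝ) = Real.sqrt (2 ^ 2) by rw [Real.sqrt_sq (by norm_num)]]
        exact Real.sqrt_le_sqrt (by push_cast at h4' ⊢; linarith)
      nlinarith [hs2sq, Real.sqrt_nonneg 2]
  · intro h
    have h' : (sqNormInt (v - w) : ℝ) ≤ ((2 : ℤ) : ℝ) := by exact_mod_cast h
    calc Real.sqrt (sqNormInt (v - w) : ℝ) ≤ Real.sqrt 2 := Real.sqrt_le_sqrt (by push_cast at h' ⊢; linarith)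
      _ ≤ Real.sqrt 2 * (1 + 1 / 50) := by nlinarith [Real.sqrt_nonneg 2]

/-- pair distances of the fcc pattern: `≥ 49/50`, and `≤ 51/50` (the bond `1`) or `≥ 63/50` (`√2, √3, 2`). [cite: HalesDSP2012, §1.3] -/
theorem fcc_pairs : ∀ x ∈ fccKissingPattern, ∀ y ∈ fccKissingPattern, x ≠ y →
    1 - 1 / 50 ≤ dist x y ∧ (dist x y ≤ 1 + 1 / 50 ∨ 63 / 50 ≤ dist x y) := by
  intro x hx y hy hxy
  refine ⟨le_trans (by norm_num) (one_le_dist_of_mem_fccKissingPattern hx hy hxy), ?_⟩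
  rw [fcc_eq_image] at hx hy
  obtain ⟨v, hv, rfl⟩ := Finset.mem_image.1 hx
  obtain ⟨w, hw, rfl⟩ := Finset.mem_image.1 hy
  have hvw : v ≠ w := by rintro rfl; exact hxy rfl
  rcases fccInt_gap v hv w hw hvw with h2 | h4
  · exact Or.inl ((dist_fmap_le_iff hv hw hvw).2 h2)
  · right
    have hs2 : 0 < Real.sqrt 2 := Real.sqrt_pos.2 (by norm_num)
    have hs2sq : Real.sqrt 2 ^ 2 = 2 := Real.sq_sqrt (by norm_num)
    have h4' : ((4 : ℤ) : ℝ) ≤ (sqNormInt (v - w) : ℝ) := by exact_mod_cast h4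
    have h2le : (2 : ℝ) ≤ Real.sqrt (sqNormInt (v - w) : ℝ) := by
      rw [show (2 : ℝ) = Real.sqrt (2 ^ 2) by rw [Real.sqrt_sq (by norm_num)]]
      exact Real.sqrt_le_sqrt (by push_cast at h4' ⊢; linarith)
    rw [dist_fmap, le_inv_mul_iff₀ hs2]
    have hs2lt : Real.sqrt 2 ≤ 3 / 2 := by nlinarith [hs2sq, Real.sqrt_nonneg 2]
    nlinarith

/-- bond-degrees of the fcc pattern are exactly four. [cite: HalesDSP2012, §1.3] -/
theorem fcc_degree : ∀ x ∈ fccKissingPattern,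
    (fccKissingPattern.filter fun w => w ≠ x ∧ dist x w ≤ 1 + 1 / 50).card = 4 := by
  classical
  intro x hx
  rw [fcc_eq_image] at hx ⊢
  obtain ⟨v, hv, rfl⟩ := Finset.mem_image.1 hx
  rw [← fccInt_degree v hv, Finset.filter_image, Finset.card_image_of_injective _ fmap_injective]
  congr 1
  apply Finset.filter_congr
  intro w hw
  simp only [fmap_injective.ne_iff]
  constructor
  · rintro ⟨hne, hd⟩; exact ⟨hne, (dist_fmap_le_iff hv hw (Ne.symm hne)).1 hd⟩
  · rintro ⟨hne, hd⟩; exact ⟨hne, (dist_fmap_le_iff hv hw (Ne.symm hne)).2 hd⟩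

/-- the translation vector `(3, 0, 0)` [folklore] -/
def cvec : (EuclideanSpace ℝ (Fin 3)) := intVec ![3, 0, 0]
/-- its norm is `3`. [folklore] -/
theorem norm_cvec : ‖cvec‖ = 3 := by
  rw [cvec, norm_intVec]
  rw [show ((sqNormInt ![3, 0, 0] : ℤ) : ℝ) = 3 ^ 2 by simp [sqNormInt]; norm_num]
  exact Real.sqrt_sq (by norm_num)

/-- **the translated witness** `fcc + (3,0,0)` [folklore] -/
def Tc : Finset (EuclideanSpace ℝ (Fin 3)) := fccKissingPattern.image fun x => x + cvec

/-- translation is injective. [folklore] -/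
theorem tr_injective : Function.Injective fun x : (EuclideanSpace ℝ (Fin 3)) => x + cvec := fun x y h => by simpa using h

/-- twelve points. [folklore] -/
theorem Tc_card : Tc.card = 12 := by
  rw [Tc, Finset.card_image_of_injective _ tr_injective, card_fccKissingPattern]

/-- pair hypotheses (hard core, bond-or-far) for the translated shell. [folklore] -/
theorem Tc_pairs : ∀ x ∈ Tc, ∀ y ∈ Tc, x ≠ y → 1 - 1 / 50 ≤ dist x y ∧ (dist x y ≤ 1 + 1 / 50 ∨ 63 / 50 ≤ dist x y) := by
  intro x hx y hy hxy
  obtain ⟨a, ha, rfl⟩ := Finset.mem_image.1 hx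
  obtain ⟨b, hb, rfl⟩ := Finset.mem_image.1 hy
  have hab : a ≠ b := by rintro rfl; exact hxy rfl
  have hd : dist (a + cvec) (b + cvec) = dist a b := by simp
  rw [hd]
  exact fcc_pairs a ha b hb hab

/-- all bond-degrees of the translated shell are four. [folklore] -/
theorem Tc_degree : ∀ x ∈ Tc, (Tc.filter fun w => w ≠ x ∧ dist x w ≤ 1 + 1 / 50).card = 4 := by
  classical
  intro x hx
  obtain ⟨a, ha, rfl⟩ := Finset.mem_image.1 hx
  rw [← fcc_degree a ha, Tc, Finset.filter_image, Finset.card_image_of_injective _ tr_injective]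
  congr 1
  apply Finset.filter_congr
  intro w _
  simp [tr_injective.ne_iff]

/-- no `1/5`-matching of the translated shell with any isometric copy of a unit-sphere pattern. [folklore] -/
theorem Tc_not_close {P : Finset (EuclideanSpace ℝ (Fin 3))} (hP : ∀ p ∈ P, ‖p‖ = 1) : ¬ ShellCloseTo (1 / 5) Tc P := by
  classical
  rintro ⟨A, e, he⟩
  have hmem : fmap ![1, 1, 0] + cvec ∈ Tc :=
    Finset.mem_image_of_mem _ (by rw [fcc_eq_image]; exact Finset.mem_image_of_mem _ (by decide))
  set t0 : ↥Tc := ⟨_, hmem⟩ with ht0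
  have h1 : ‖(t0 : (EuclideanSpace ℝ (Fin 3)))‖ ≥ 2 := by
    have hp : ‖fmap ![1, 1, 0]‖ = 1 :=
      norm_eq_one_of_mem_fccKissingPattern (by rw [fcc_eq_image]; exact Finset.mem_image_of_mem _ (by decide))
    have := norm_sub_norm_le cvec (-(fmap ![1, 1, 0]))
    rw [norm_neg, norm_cvec, hp, sub_neg_eq_add, add_comm] at this
    change ‖fmap ![1, 1, 0] + cvec‖ ≥ 2
    linarith
  have h2 : ‖((e t0 : ↥(P.image A)) : (EuclideanSpace ℝ (Fin 3)))‖ = 1 := by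
    obtain ⟨p, hp, hpe⟩ := Finset.mem_image.1 (e t0).2
    rw [← hpe, LinearIsometry.norm_map, hP p hp]
  have h3 := he t0
  have h4 : ‖(t0 : (EuclideanSpace ℝ (Fin 3)))‖ - ‖((e t0 : ↥(P.image A)) : (EuclideanSpace ℝ (Fin 3)))‖ ≤ dist (t0 : (EuclideanSpace ℝ (Fin 3))) (e t0 : (EuclideanSpace ℝ (Fin 3))) := by
    rw [dist_eq_norm]; exact norm_sub_norm_le _ _
  linarith

/-- **The radius window is load-bearing**: `ShellTrichotomy` with `49/50 ≤ ‖v‖ ≤ 51/50` deleted is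
FALSE (translated cuboctahedron). Any proof must use the radii — in the crux they fix the centre to
within `1/50`, which is what makes "after a LINEAR isometry" the right closeness notion. [folklore] -/
theorem shellTrichotomy_false_without_radiusWindow :
    ¬ (∀ T : Finset (EuclideanSpace ℝ (Fin 3)), T.card = 12 →
      (∀ v ∈ T, ∀ w ∈ T, v ≠ w → 1 - 1 / 50 ≤ dist v w ∧ (dist v w ≤ 1 + 1 / 50 ∨ 63 / 50 ≤ dist v w)) →
      ShellCloseTo (1 / 5) T fccKissingPattern ∨ ShellCloseTo (1 / 5) T hcpKissingPattern ∨
      (∃ v ∈ T, 5 ≤ (T.filter fun w => w ≠ v ∧ dist v w ≤ 1 + 1 / 50).card) ∨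
      (∃ v ∈ T, (T.filter fun w => w ≠ v ∧ dist v w ≤ 1 + 1 / 50).card ≤ 3)) := by
  intro h
  rcases h Tc Tc_card Tc_pairs with hA | hA | ⟨v, hv, h5⟩ | ⟨v, hv, h3⟩
  · exact Tc_not_close (fun p hp => norm_eq_one_of_mem_fccKissingPattern hp) hA
  · exact Tc_not_close (fun p hp => norm_eq_one_of_mem_hcpKissingPattern hp) hA
  · rw [Tc_degree v hv] at h5; omega
  · rw [Tc_degree v hv] at h3; omega

/-! ### The cardinality hypothesis is load-bearing (degenerately): the empty shell

Without `T.card = 12` the empty set satisfies the other hypotheses vacuously, is matched to nothing,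
and has no vertex to be capped or torn. (Degenerate, recorded only so that the hypothesis census is complete.) -/

/-- the empty shell refutes the card-free variant. [folklore] -/
theorem shellTrichotomy_false_without_card :
    ¬ (∀ T : Finset (EuclideanSpace ℝ (Fin 3)), (∀ v ∈ T, 1 - 1 / 50 ≤ ‖v‖ ∧ ‖v‖ ≤ 1 + 1 / 50) →
      (∀ v ∈ T, ∀ w ∈ T, v ≠ w → 1 - 1 / 50 ≤ dist v w ∧ (dist v w ≤ 1 + 1 / 50 ∨ 63 / 50 ≤ dist v w)) →
      ShellCloseTo (1 / 5) T fccKissingPattern ∨ ShellCloseTo (1 / 5) T hcpKissingPattern ∨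
      (∃ v ∈ T, 5 ≤ (T.filter fun w => w ≠ v ∧ dist v w ≤ 1 + 1 / 50).card) ∨
      (∃ v ∈ T, (T.filter fun w => w ≠ v ∧ dist v w ≤ 1 + 1 / 50).card ≤ 3)) := by
  intro h
  rcases h ∅ (by simp) (by simp) with hA | hA | ⟨v, hv, _⟩ | ⟨v, hv, _⟩
  · have := hA.card_eq; rw [card_fccKissingPattern] at this; simp at this
  · have := hA.card_eq; rw [card_hcpKissingPattern] at this; simp at this
  · simp at hv
  · simp at hv


end Summit.AtomisticToContinuum.Crystallization.Theorems.ShellTrichotomyNegative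

end
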